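import Literature.Probability.Percolation.QuadCrossingSeparatorArmOff
import Literature.Probability.Percolation.QuadCrossingSubquadArm
import Literature.Probability.Percolation.QuadCrossingFlip
import HarnessLib

/-!
# The middle closed arm: an excursion of the dual separator between the lowest and the uppermost wall

Topic `Probability/Percolation`; proofs file towards the named fact `SchrammSmirnov2011_lemma_6_1`
(`QuadCrossingContinuity.lean`; O. Schramm, S. Smirnov, *On the scaling limits of planar
percolation*, Ann. Probab. 39 (2011), arXiv:1101.5820, proof of Lemma 6.1, case (2), p. 22: "We will
work with configurations with a crossing landing on `σ₃`, the other case being symmetric, with the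
lowest crossing replaced by the uppermost … there is a dual closed crossing from `∂₃Q` to
`(σ₃ ∩ M̄) ∪ ∂₁Q`, in particular crossing the annulus `A(x, δ, d₁/2)` inside `[Q] ∖ M`").

The printed proof cuts the free side at one point into `σ₁ ∪ σ₃` so that the landing point `x` of
the lowest crossing is far from `∂₃Q` or the landing point `x'` of the uppermost one is far from
`∂₁Q`.  Such a cut need not exist for a general free side.  This file supplies the closed arm of the
remaining case — `x` close to `∂₃Q` AND `x'` close to `∂₁Q` — without any cut: with the lower wall
`W = L ∪ E` (lowest crossing and its exit set, region `M` below it) and the upper wall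
`W' = L' ∪ E'` (uppermost crossing and its exit set, region `M'` above it),

* `Quad.exists_excursion` — the dual separator `β` of `Q` (from `∂₁Q ⊆ M` to `∂₃Q ⊆ M'`) has an
  excursion outside `M ∪ M'` from a point of `W` to a point of `W'`, provided its contacts with `W`
  are not above `W'` (last exit from `M`, then first entry into `M'`, realised as the last exit of the
  reversed path from the region below `W'` in the flipped quad `Quad.flip`);
* `Quad.mem_annulusDualCrossingOff_mid` — that excursion runs from `E` (within `R₁` of `x`) to `E'`
  (within `R₁` of `x'`); chained with a short junction of `x` to `∂₃Q` and of `x'` to `∂₁Q` it joins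
  `∂₃Q` to `∂₁Q`, so it has diameter `≥ d₁(Q) - 2c₃ - 4R₁`; hence it crosses one of two annuli about
  `x` chosen (`midInner`, `midOuter`) to avoid the ball `B(x', r₀)` where the upper exploration's
  revealed closed edges may leave `M'` — using no edge of the set `S` of edges whose closed segments
  leave `M` only next to `x` and leave `M'` only next to `x'` (the no-leak property of both
  explorations under lattice tameness).

Everything is proved; no named fact is introduced.

## References

* O. Schramm, S. Smirnov, Ann. Probab. 39 (2011) 1768–1814, arXiv:1101.5820, proof of Lemma 6.1,
  case (2), eq. (6.2). [SchrammSmirnov2011]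
-/

noncomputable section

open scoped unitInterval
open Set Filter Metric Function
open _root_.Topology
open Literature.Probability.LatticeModels

namespace Literature.Probability.Percolation

namespace QuadCrossing

variable {D : Set ℂ}

namespace Quad

variable {Q : Quad D}

/-! ### The region above a wall, via the flipped quad -/

/-- The region of the flipped quad below `W` is the region of `Q` above `W`: points all of whose
junctions to `∂₁Q` meet `W`. [cite: SchrammSmirnov2011, proof of Lemma 6.1, case (2)] -/
theorem flip_below_eq (Q : Quad D) (W : Set ℂ) :
    {z | z ∈ Q.flip.carrier ∧ ∀ t ∈ Q.flip.side 3, ∀ p : Path z t,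
      range p ⊆ Q.flip.carrier → (range p ∩ W).Nonempty} =
    {z | z ∈ Q.carrier ∧ ∀ t ∈ Q.side 1, ∀ p : Path z t,
      range p ⊆ Q.carrier → (range p ∩ W).Nonempty} := by
  ext z
  simp only [mem_setOf_eq, flip_carrier, flip_side_three]

/-! ### The excursion between the two walls -/

/-- **An excursion of a path between two walls.**  Let `W, W' ⊆ ℂ` be closed, `M` the region of
`[Q]` below `W` and `M'` the region above `W'` (below `W'` in the flipped quad).  A path of `[Q]`
from a point of `M` to a point of `∂₃Q` in `M'`, whose points on `W` are never in `M'`, has two times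
`sσ < sτ` with `β sσ ∈ W`, `β sτ ∈ W'` and `β` off `M ∪ M'` strictly in between: `sσ` is the last visit
to `M` (a point of `W`, not in `M'` by hypothesis) and `sτ` the first visit to `M'` after it (the last
visit of the reversed path, a point of `W'`). [cite: SchrammSmirnov2011, proof of Lemma 6.1, case (2)] -/
theorem exists_excursion {W W' : Set ℂ} (hW : IsClosed W) (hW' : IsClosed W') {β : ℝ → ℂ}
    (hβ : ContinuousOn β (Icc 0 1)) (hβQ : MapsTo β (Icc 0 1) Q.carrier)
    (hβ0 : β 0 ∈ {z | z ∈ Q.carrier ∧ ∀ t ∈ Q.side 3, ∀ p : Path z t,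
      range p ⊆ Q.carrier → (range p ∩ W).Nonempty})
    (hβ13 : β 1 ∈ Q.side 3)
    (hβ1 : β 1 ∈ {z | z ∈ Q.flip.carrier ∧ ∀ t ∈ Q.flip.side 3, ∀ p : Path z t,
      range p ⊆ Q.flip.carrier → (range p ∩ W').Nonempty})
    (hβW : ∀ t ∈ Icc (0 : ℝ) 1, β t ∈ W → β t ∉ {z | z ∈ Q.flip.carrier ∧
      ∀ t ∈ Q.flip.side 3, ∀ p : Path z t, range p ⊆ Q.flip.carrier → (range p ∩ W').Nonempty}) :
    ∃ sσ sτ : ℝ, 0 ≤ sσ ∧ sσ < sτ ∧ sτ ≤ 1 ∧ β sσ ∈ W ∧ β sτ ∈ W' ∧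
      ∀ u ∈ Ioo sσ sτ,
        β u ∉ {z | z ∈ Q.carrier ∧ ∀ t ∈ Q.side 3, ∀ p : Path z t,
          range p ⊆ Q.carrier → (range p ∩ W).Nonempty} ∧
        β u ∉ {z | z ∈ Q.flip.carrier ∧ ∀ t ∈ Q.flip.side 3, ∀ p : Path z t,
          range p ⊆ Q.flip.carrier → (range p ∩ W').Nonempty} := by
  set M : Set ℂ := {z | z ∈ Q.carrier ∧ ∀ t ∈ Q.side 3, ∀ p : Path z t,
      range p ⊆ Q.carrier → (range p ∩ W).Nonempty} with hM
  set M' : Set ℂ := {z | z ∈ Q.flip.carrier ∧ ∀ t ∈ Q.flip.side 3, ∀ p : Path z t,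
      range p ⊆ Q.flip.carrier → (range p ∩ W').Nonempty} with hM'
  -- the endpoint is not on `W`, hence not below `W`
  have hβ1W : β 1 ∉ W := fun h => hβW 1 (right_mem_Icc.2 zero_le_one) h hβ1
  have hβ1M : β 1 ∉ M :=
    not_mem_below_of_path_avoiding hβ13 (Path.refl (β 1))
      (by rintro _ ⟨t, rfl⟩; exact hβQ (right_mem_Icc.2 zero_le_one)) (fun _ => by simpa using hβ1W)
  -- last visit to `M`
  obtain ⟨sσ, hσI, hσW, hafterσ⟩ := exists_final_segment_avoiding_below hW hβ hβQ hβ0 hβ1M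
  have hσM' : β sσ ∉ M' := hβW sσ ⟨hσI.1, hσI.2.le⟩ hσW
  -- the reversed path from `β 1` to `β sσ`, in the flipped quad
  have hγmaps : ∀ t ∈ Icc (0 : ℝ) 1, 1 + t * (sσ - 1) ∈ Icc (0 : ℝ) 1 := fun t ht =>
    ⟨by nlinarith [ht.1, ht.2, hσI.1, hσI.2], by nlinarith [ht.1, ht.2, hσI.1, hσI.2]⟩
  set γ : ℝ → ℂ := fun t => β (1 + t * (sσ - 1)) with hγ
  have hγc : ContinuousOn γ (Icc 0 1) := hβ.comp (by fun_prop) fun t ht => hγmaps t ht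
  have hγ0 : γ 0 = β 1 := by simp [hγ]
  have hγ1 : γ 1 = β sσ := by simp [hγ]
  have hγQ : MapsTo γ (Icc 0 1) Q.flip.carrier := fun t ht => by
    rw [flip_carrier]; exact hβQ (hγmaps t ht)
  have hγ0M' : γ 0 ∈ M' := by rw [hγ0]; exact hβ1
  have hγ1M' : γ 1 ∉ M' := by rw [hγ1]; exact hσM'
  obtain ⟨s, hsI, hsW', hafters⟩ :=
    exists_final_segment_avoiding_below (Q := Q.flip) hW' hγc hγQ hγ0M' hγ1M'
  -- the first entry time `sτ` after `sσ`
  set sτ : ℝ := 1 + s * (sσ - 1) with hτ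
  have hστ : sσ < sτ := by rw [hτ]; nlinarith [hsI.2, hσI.2]
  have hτ1 : sτ ≤ 1 := by rw [hτ]; nlinarith [hsI.1, hσI.2]
  refine ⟨sσ, sτ, hσI.1, hστ, hτ1, hσW, hsW', fun u hu => ⟨?_, ?_⟩⟩
  · exact hafterσ u ⟨hu.1, hu.2.le.trans hτ1⟩
  · -- `u = 1 + v (sσ - 1)` with `v ∈ (s, 1]`
    have hσ1 : 0 < 1 - sσ := by linarith [hσI.2]
    set v : ℝ := (1 - u) / (1 - sσ) with hv
    have huv : 1 + v * (sσ - 1) = u := by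
      rw [hv]; field_simp; ring
    have hv1 : v ≤ 1 := by
      rw [hv, div_le_one hσ1]; linarith [hu.1]
    have hsv : s < v := by
      rw [hv, lt_div_iff₀ hσ1]
      have : u < 1 + s * (sσ - 1) := hu.2
      nlinarith
    have := hafters v ⟨hsv, hv1⟩
    rwa [show γ v = β u by simp only [hγ, huv]] at this

/-! ### The two annuli about the lower landing point -/

/-- Inner radius of the middle arm's annulus about `x`: `r₀` when the upper landing point is at
distance `≥ 2ρₘ` from `x`, else `3ρₘ`. [cite: SchrammSmirnov2011, proof of Lemma 6.1, case (2)] -/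
def midInner (s r₀ ρm : ℝ) : ℝ := if 2 * ρm ≤ s then r₀ else 3 * ρm

/-- Outer radius of the middle arm's annulus about `x`: `ρₘ` when the upper landing point is at
distance `≥ 2ρₘ` from `x`, else `R₀`. [cite: SchrammSmirnov2011, proof of Lemma 6.1, case (2)] -/
def midOuter (s ρm R₀ : ℝ) : ℝ := if 2 * ρm ≤ s then ρm else R₀

/-- The radii are nested between `r₀` and `R₀` with room `2δ`. [folklore] -/
theorem midRadii_spec (s : ℝ) {r₀ ρm R₀ δ : ℝ} (hr₀ : 0 ≤ r₀) (h₁ : r₀ + 2 * δ ≤ ρm)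
    (h₂ : 3 * ρm + 2 * δ ≤ R₀) (hδ : 0 ≤ δ) :
    r₀ ≤ midInner s r₀ ρm ∧ midInner s r₀ ρm + 2 * δ ≤ midOuter s ρm R₀ ∧ midOuter s ρm R₀ ≤ R₀ := by
  by_cases h : 2 * ρm ≤ s
  · simp only [midInner, midOuter, h, if_true]
    exact ⟨le_rfl, h₁, by linarith⟩
  · simp only [midInner, midOuter, h, if_false]
    exact ⟨by linarith, h₂, le_rfl⟩

/-- **The annulus avoids the upper landing point**: a point whose distance to `x` lies between the
two radii is at distance `≥ ρₘ ≥ r₀` from a point `x'` with `dist x' x = s`. [folklore] -/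
theorem le_dist_of_midRadii {x x' q : ℂ} {s r₀ ρm R₀ : ℝ} (hs : dist x' x = s) (hr : r₀ ≤ ρm)
    (h1 : midInner s r₀ ρm ≤ dist q x) (h2 : dist q x ≤ midOuter s ρm R₀) : r₀ ≤ dist q x' := by
  by_cases h : 2 * ρm ≤ s
  · simp only [midInner, midOuter, h, if_true] at h1 h2
    have := dist_triangle x' q x
    rw [dist_comm x' q] at this
    linarith
  · simp only [midInner, midOuter, h, if_false] at h1 h2
    push Not at h
    have := dist_triangle q x' x
    linarith

/-! ### The middle arm -/

/-- **The middle closed arm, using no edge of `S`** (see the module docstring).  Lower data: the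
lowest crossing `L` (compact, connected, on open edges, meeting `∂₀Q`) with landing point `x ∈ L`
and exit set `E ∋ x` (compact, preconnected, in `[Q]`, meeting `∂₂Q`, junctions within `R₁` of `x`);
upper data `L', x', E'` likewise; the points of `E` are not above the upper wall `L' ∪ E'`; `x` is
joined to `∂₃Q` and `x'` to `∂₁Q` by paths of diameter `< c₃`; and every point of the segment of a
closed edge of `S` inside `[Q]` that is neither below `L ∪ E` nor above `L' ∪ E'` is a lattice
vertex or within `r₀` of `x` or of `x'`, `R₁ < r₀`.  If `r₀ + 2δ ≤ ρₘ`, `3ρₘ + 2δ ≤ R₀`,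
`2R₀ + 2c₃ + 4R₁ ≤ d₁(Q)` and `Q` has no crossing inside the open edges, then
`ω ∈ annulusDualCrossingOff S x δ (midInner s r₀ ρₘ + 2δ) (midOuter s ρₘ R₀ - 2δ)`, `s = dist x' x`.
[cite: SchrammSmirnov2011, proof of Lemma 6.1, case (2), eq. (6.2)] -/
theorem mem_annulusDualCrossingOff_mid {δ : ℝ} (hδ : 0 < δ) {ω : BondConfig (Site 2)}
    {L E : Set ℂ} (hLc : IsCompact L) (hLconn : IsConnected L) (hLQ : L ⊆ Q.carrier)
    (hLO : L ⊆ openEdgeUnion δ ω) (hL0 : (L ∩ Q.side 0).Nonempty) {x : ℂ} (hxL : x ∈ L)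
    (hEc : IsCompact E) (hEpc : IsPreconnected E) (hEQ : E ⊆ Q.carrier) (hxE : x ∈ E)
    (hE2 : (E ∩ Q.side 2).Nonempty) {R₁ : ℝ} (hR₁ : 0 ≤ R₁)
    (hEjoin : ∀ e ∈ E, ∃ p : Path x e, range p ⊆ Q.carrier ∧ ∀ s, dist (p s) x ≤ R₁)
    {L' E' : Set ℂ} (hL'c : IsCompact L') (hL'conn : IsConnected L') (hL'Q : L' ⊆ Q.carrier)
    (hL'O : L' ⊆ openEdgeUnion δ ω) (hL'0 : (L' ∩ Q.side 0).Nonempty) {x' : ℂ} (hx'L' : x' ∈ L')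
    (hE'c : IsCompact E') (hE'pc : IsPreconnected E') (hE'Q : E' ⊆ Q.carrier) (hx'E' : x' ∈ E')
    (hE'2 : (E' ∩ Q.side 2).Nonempty)
    (hE'join : ∀ e ∈ E', ∃ p : Path x' e, range p ⊆ Q.carrier ∧ ∀ s, dist (p s) x' ≤ R₁)
    (hEM' : ∀ e ∈ E, e ∉ {z | z ∈ Q.carrier ∧ ∀ t ∈ Q.side 1, ∀ p : Path z t,
      range p ⊆ Q.carrier → (range p ∩ (L' ∪ E')).Nonempty})
    {c₃ : ℝ}
    (hnear₃ : ∃ t ∈ Q.side 3, ∃ p : Path x t, range p ⊆ Q.carrier ∧ Metric.diam (range p) < c₃)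
    (hnear₁ : ∃ t ∈ Q.side 1, ∃ p : Path x' t, range p ⊆ Q.carrier ∧ Metric.diam (range p) < c₃)
    {r₀ ρm R₀ : ℝ} (hR₁r : R₁ < r₀) (hslack₁ : r₀ + 2 * δ ≤ ρm) (hslack₂ : 3 * ρm + 2 * δ ≤ R₀)
    (hR₀ : 2 * R₀ + 2 * c₃ + 4 * R₁ ≤ Q.sideDist 1) {S : Set (Sym2 (Site 2))}
    (hS : ∀ a b : Site 2, (zdGraph 2).Adj a b → s(a, b) ∈ S → s(a, b) ∉ ω →
      ∀ q ∈ segment ℝ (meshPoint δ a) (meshPoint δ b), q ∈ Q.carrier →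
        q ∉ {z | z ∈ Q.carrier ∧ ∀ t ∈ Q.side 3, ∀ p : Path z t,
          range p ⊆ Q.carrier → (range p ∩ (L ∪ E)).Nonempty} →
        q ∉ {z | z ∈ Q.carrier ∧ ∀ t ∈ Q.side 1, ∀ p : Path z t,
          range p ⊆ Q.carrier → (range p ∩ (L' ∪ E')).Nonempty} →
        q ∈ range (meshPoint δ) ∨ dist q x < r₀ ∨ dist q x' < r₀)
    (hnot : ¬ ∃ K, Q.IsCrossing K ∧ K ⊆ openEdgeUnion δ ω) :
    ω ∈ annulusDualCrossingOff S x δ (midInner (dist x' x) r₀ ρm + 2 * δ)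
      (midOuter (dist x' x) ρm R₀ - 2 * δ) := by
  -- radii
  set inner : ℝ := midInner (dist x' x) r₀ ρm with hinner
  set outer : ℝ := midOuter (dist x' x) ρm R₀ with houter
  obtain ⟨hr₀i, hio, hoR⟩ := midRadii_spec (dist x' x) (hR₁.trans hR₁r.le) hslack₁ hslack₂ hδ.le
  have hρm : r₀ ≤ ρm := by linarith
  have hio' : inner < outer := by rw [hinner, houter]; linarith
  have hexcl : ∀ q : ℂ, inner ≤ dist q x → dist q x ≤ outer → r₀ ≤ dist q x' := fun q h1 h2 =>
    le_dist_of_midRadii rfl hρm h1 h2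
  -- junctions are close
  have hEx : ∀ e ∈ E, dist e x ≤ R₁ := fun e he => by
    obtain ⟨p, -, hp⟩ := hEjoin e he
    simpa [p.target] using hp 1
  have hE'x : ∀ e ∈ E', dist e x' ≤ R₁ := fun e he => by
    obtain ⟨p, -, hp⟩ := hE'join e he
    simpa [p.target] using hp 1
  -- the dual path of `Q`
  obtain ⟨β, hβc, hβQ, hβ0, hβ1, hβO⟩ := Q.exists_path_avoiding_of_not_exists_isCrossing hδ hnot
  -- the two walls and their regions
  set W : Set ℂ := L ∪ E with hW
  set W' : Set ℂ := L' ∪ E' with hW'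
  have hWc : IsCompact W := hLc.union hEc
  have hWconn : IsPreconnected W :=
    IsPreconnected.union x hxL hxE hLconn.isPreconnected hEpc
  have hWQ : W ⊆ Q.carrier := union_subset hLQ hEQ
  have hW0 : (W ∩ Q.side 0).Nonempty := hL0.mono (inter_subset_inter_left _ subset_union_left)
  have hW2 : (W ∩ Q.side 2).Nonempty := hE2.mono (inter_subset_inter_left _ subset_union_right)
  have hW'c : IsCompact W' := hL'c.union hE'c
  have hW'conn : IsPreconnected W' :=
    IsPreconnected.union x' hx'L' hx'E' hL'conn.isPreconnected hE'pc
  have hW'Q : W' ⊆ Q.flip.carrier := by rw [flip_carrier]; exact union_subset hL'Q hE'Q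
  have hW'0 : (W' ∩ Q.flip.side 0).Nonempty := by
    rw [flip_side_zero]; exact hL'0.mono (inter_subset_inter_left _ subset_union_left)
  have hW'2 : (W' ∩ Q.flip.side 2).Nonempty := by
    rw [flip_side_two]; exact hE'2.mono (inter_subset_inter_left _ subset_union_right)
  set M : Set ℂ := {z | z ∈ Q.carrier ∧ ∀ t ∈ Q.side 3, ∀ p : Path z t,
      range p ⊆ Q.carrier → (range p ∩ W).Nonempty} with hM
  set M' : Set ℂ := {z | z ∈ Q.flip.carrier ∧ ∀ t ∈ Q.flip.side 3, ∀ p : Path z t,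
      range p ⊆ Q.flip.carrier → (range p ∩ W').Nonempty} with hM'
  have hM'eq : M' = {z | z ∈ Q.carrier ∧ ∀ t ∈ Q.side 1, ∀ p : Path z t,
      range p ⊆ Q.carrier → (range p ∩ W').Nonempty} := Q.flip_below_eq W'
  -- `β 0` is below `W`, `β 1` is above `W'`
  have hβ0M : β 0 ∈ M := Quad.side_one_subset_below hWc hWconn hWQ hW0 hW2 hβ0
  have hβ1M' : β 1 ∈ M' := by
    have h1 : β 1 ∈ Q.flip.side 1 := by rw [flip_side_one]; exact hβ1
    exact Quad.side_one_subset_below hW'c hW'conn hW'Q hW'0 hW'2 h1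
  -- contacts of `β` with `W` are in `E`, hence not above `W'`
  have hβE : ∀ t ∈ Icc (0 : ℝ) 1, β t ∈ W → β t ∈ E := fun t ht h => by
    rcases h with h | h
    · exact absurd (hLO h) (hβO t ht).1
    · exact h
  have hβW : ∀ t ∈ Icc (0 : ℝ) 1, β t ∈ W → β t ∉ M' := fun t ht h => by
    rw [hM'eq]; exact hEM' _ (hβE t ht h)
  -- the excursion
  obtain ⟨sσ, sτ, hσ0, hστ, hτ1, hσW, hτW', hexc⟩ :=
    Quad.exists_excursion hWc.isClosed hW'c.isClosed hβc hβQ hβ0M hβ1 hβ1M' hβW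
  have hσI : sσ ∈ Icc (0 : ℝ) 1 := ⟨hσ0, hστ.le.trans hτ1⟩
  have hτI : sτ ∈ Icc (0 : ℝ) 1 := ⟨hσ0.trans hστ.le, hτ1⟩
  have hσE : β sσ ∈ E := hβE sσ hσI hσW
  have hτE' : β sτ ∈ E' := by
    rcases hτW' with h | h
    · exact absurd (hL'O h) (hβO sτ hτI).1
    · exact h
  -- reparametrise the excursion: `γ : [0,1] → [Q]` from `β sσ ∈ E` to `β sτ ∈ E'`
  obtain ⟨hγc, hγ0, hγ1, hγmaps⟩ := exists_reparam hβc hσ0 hστ.le hτ1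
  set γ : ℝ → ℂ := fun t => β (sσ + t * (sτ - sσ)) with hγ
  have hγI : ∀ t ∈ Icc (0 : ℝ) 1, sσ + t * (sτ - sσ) ∈ Icc (0 : ℝ) 1 := fun t ht =>
    let h := hγmaps t ht; ⟨hσ0.trans h.1, h.2.trans hτ1⟩
  have hγO : ∀ t ∈ Icc (0 : ℝ) 1, γ t ∉ openEdgeUnion δ ω ∧ γ t ∉ range (meshPoint δ) := fun t ht =>
    hβO _ (hγI t ht)
  have hγQ : ∀ t ∈ Icc (0 : ℝ) 1, γ t ∈ Q.carrier := fun t ht => hβQ (hγI t ht)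
  have hγout : ∀ t ∈ Ioo (0 : ℝ) 1, γ t ∉ M ∧ γ t ∉ M' := fun t ht => by
    refine hexc (sσ + t * (sτ - sσ)) ⟨?_, ?_⟩
    · nlinarith [ht.1]
    · nlinarith [ht.2]
  have hγ0x : dist (γ 0) x ≤ R₁ := by rw [hγ0]; exact hEx _ hσE
  have hγ1x' : dist (γ 1) x' ≤ R₁ := by rw [hγ1]; exact hE'x _ hτE'
  -- the excursion has diameter `≥ 2 R₀`: chain it with the short junctions into a `∂₁Q–∂₃Q` path
  obtain ⟨pγ, hpγ⟩ := exists_path_of_continuousOn hγc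
  have hpγr : range pγ ⊆ γ '' Icc 0 1 := by
    rintro _ ⟨t, rfl⟩; exact ⟨t, t.2, (hpγ t).symm⟩
  have hpγQ : range pγ ⊆ Q.carrier := hpγr.trans (by rintro _ ⟨t, ht, rfl⟩; exact hγQ t ht)
  have hdiamγ : 2 * R₀ ≤ Metric.diam (range pγ) := by
    obtain ⟨t₃, ht₃, p₃, hp₃Q, hp₃d⟩ := hnear₃
    obtain ⟨t₁, ht₁, p₁, hp₁Q, hp₁d⟩ := hnear₁
    obtain ⟨j₀, hj₀Q, hj₀⟩ := hEjoin _ (show γ 0 ∈ E by rw [hγ0]; exact hσE)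
    obtain ⟨j₁, hj₁Q, hj₁⟩ := hE'join _ (show γ 1 ∈ E' by rw [hγ1]; exact hτE')
    have hdj₀ : Metric.diam (range j₀) ≤ 2 * R₁ := by
      refine Metric.diam_le_of_forall_dist_le (by positivity) ?_
      rintro _ ⟨a, rfl⟩ _ ⟨b, rfl⟩
      linarith [dist_triangle (j₀ a) x (j₀ b), dist_comm x (j₀ b), hj₀ a, hj₀ b]
    have hdj₁ : Metric.diam (range j₁) ≤ 2 * R₁ := by
      refine Metric.diam_le_of_forall_dist_le (by positivity) ?_
      rintro _ ⟨a, rfl⟩ _ ⟨b, rfl⟩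
      linarith [dist_triangle (j₁ a) x' (j₁ b), dist_comm x' (j₁ b), hj₁ a, hj₁ b]
    -- the chain `t₁ → x' → γ 1 → γ 0 → x → t₃`
    let big : Path t₁ t₃ := p₁.symm.trans (j₁.trans (pγ.symm.trans (j₀.symm.trans p₃)))
    have hbig_range : range big = range p₁ ∪ (range j₁ ∪ (range pγ ∪ (range j₀ ∪ range p₃))) := by
      simp only [big, Path.trans_range, Path.symm_range]
    have hbigQ : range big ⊆ Q.carrier := by
      rw [hbig_range]
      exact union_subset hp₁Q (union_subset hj₁Q (union_subset hpγQ (union_subset hj₀Q hp₃Q)))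
    have hd₁ : Q.sideDist 1 ≤ Metric.diam (range big) := Quad.sideDist_le (j := 1) ht₁ ht₃ big hbigQ
    -- diameters add along the chain
    have hx3 : x ∈ range j₀ ∩ range p₃ := ⟨⟨0, j₀.source⟩, ⟨0, p₃.source⟩⟩
    have h4 : Metric.diam (range j₀ ∪ range p₃) ≤ 2 * R₁ + c₃ := by
      have := Metric.diam_union' ⟨x, hx3⟩; linarith
    have hγ0mem : γ 0 ∈ range pγ ∩ (range j₀ ∪ range p₃) :=
      ⟨⟨0, by rw [hpγ]; rfl⟩, Or.inl ⟨1, j₀.target⟩⟩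
    have h3 : Metric.diam (range pγ ∪ (range j₀ ∪ range p₃)) ≤
        Metric.diam (range pγ) + (2 * R₁ + c₃) := by
      have := Metric.diam_union' ⟨γ 0, hγ0mem⟩; linarith
    have hγ1mem : γ 1 ∈ range j₁ ∩ (range pγ ∪ (range j₀ ∪ range p₃)) :=
      ⟨⟨1, j₁.target⟩, Or.inl ⟨1, by rw [hpγ]; rfl⟩⟩
    have h2 : Metric.diam (range j₁ ∪ (range pγ ∪ (range j₀ ∪ range p₃))) ≤
        2 * R₁ + (Metric.diam (range pγ) + (2 * R₁ + c₃)) := by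
      have := Metric.diam_union' ⟨γ 1, hγ1mem⟩; linarith
    have hx'mem : x' ∈ range p₁ ∩ (range j₁ ∪ (range pγ ∪ (range j₀ ∪ range p₃))) :=
      ⟨⟨0, p₁.source⟩, Or.inl ⟨0, j₁.source⟩⟩
    have h1 : Metric.diam (range big) ≤
        c₃ + (2 * R₁ + (Metric.diam (range pγ) + (2 * R₁ + c₃))) := by
      rw [hbig_range]
      have := Metric.diam_union' ⟨x', hx'mem⟩; linarith
    linarith
  -- hence `γ` reaches distance `≥ R₀` from `x`
  have hfarpt : ∃ t ∈ Icc (0 : ℝ) 1, R₀ ≤ dist (γ t) x := by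
    by_contra hcon
    push Not at hcon
    have hK : IsCompact (range pγ) := isCompact_range pγ.continuous
    obtain ⟨m₀, hm₀, hmax⟩ := hK.exists_isMaxOn ⟨γ 0, ⟨0, by rw [hpγ]; rfl⟩⟩
      (continuous_id.dist continuous_const).continuousOn
    have hm₀lt : dist m₀ x < R₀ := by
      obtain ⟨t, ht, hteq⟩ := hpγr hm₀
      rw [← hteq]; exact hcon t ht
    have hbound : Metric.diam (range pγ) ≤ 2 * dist m₀ x := by
      refine Metric.diam_le_of_forall_dist_le (by positivity) fun u hu v hv => ?_
      have hu' : dist u x ≤ dist m₀ x := hmax hu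
      have hv' : dist v x ≤ dist m₀ x := hmax hv
      linarith [dist_triangle u x v, dist_comm x v]
    linarith
  obtain ⟨t₁, ht₁, ht₁far⟩ := hfarpt
  -- restrict `γ` to `[0, t₁]`
  obtain ⟨hγ'c, hγ'0, hγ'1, hγ'maps⟩ := exists_reparam hγc le_rfl ht₁.1 ht₁.2
  set γ' : ℝ → ℂ := fun t => γ (0 + t * (t₁ - 0)) with hγ'
  -- the last visit to `B̄(x, inner)`
  have h0lt : dist (γ' 0) x < inner := by rw [hγ'0]; linarith
  have h1gt : inner < dist (γ' 1) x := by rw [hγ'1]; linarith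
  obtain ⟨u₀, hu₀, hu₀eq, hu₀after⟩ := exists_last_le (g := fun t => dist (γ' t) x)
    ((continuous_id.dist continuous_const).comp_continuousOn hγ'c) h0lt h1gt
  -- restrict to `[u₀, 1]`, then up to the first exit from `B(x, outer)`
  obtain ⟨hγ₂c, hγ₂0, hγ₂1, hγ₂maps⟩ := exists_reparam hγ'c hu₀.1.le hu₀.2.le le_rfl
  set γ₂ : ℝ → ℂ := fun t => γ' (u₀ + t * (1 - u₀)) with hγ₂
  have h0 : dist (γ₂ 0) x < outer := by rw [hγ₂0, hu₀eq]; exact hio'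
  have h1 : outer ≤ dist (γ₂ 1) x := by rw [hγ₂1, hγ'1]; linarith
  obtain ⟨γ₃, hγ₃c, hγ₃0, hγ₃mem, hγ₃R, hγ₃1⟩ := exists_restrict_until_dist_ge hγ₂c h0 h1
  -- every point of `γ₃` is a point `γ v` with `inner ≤ dist (γ v) x ≤ outer`
  have hγ₃pts : ∀ t ∈ Icc (0 : ℝ) 1, ∃ v ∈ Icc (0 : ℝ) 1, γ₃ t = γ v ∧ inner ≤ dist (γ v) x ∧
      dist (γ v) x ≤ outer := by
    intro t ht
    obtain ⟨u, hu, hu'⟩ := hγ₃mem t ht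
    obtain ⟨hw1, hw2⟩ := hγ₂maps u hu
    set w : ℝ := u₀ + u * (1 - u₀) with hw
    have hwI : w ∈ Icc (0 : ℝ) 1 := ⟨hu₀.1.le.trans hw1, hw2⟩
    obtain ⟨hv1, hv2⟩ := hγ'maps w hwI
    refine ⟨0 + w * (t₁ - 0), ⟨hv1, hv2.trans ht₁.2⟩, by rw [← hu'], ?_, ?_⟩
    · show inner ≤ dist (γ' w) x
      rcases hw1.eq_or_lt with h | h
      · rw [← h, hu₀eq]
      · exact (hu₀after w hwI h).le
    · have := hγ₃R t ht
      rwa [← hu'] at this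
  -- such points are strictly inside the excursion, hence off `M ∪ M'`
  have hγ₃out : ∀ t ∈ Icc (0 : ℝ) 1, ∃ v ∈ Icc (0 : ℝ) 1, γ₃ t = γ v ∧ γ v ∉ M ∧ γ v ∉ M' ∧
      r₀ ≤ dist (γ v) x ∧ r₀ ≤ dist (γ v) x' := by
    intro t ht
    obtain ⟨v, hv, hveq, hvin, hvout⟩ := hγ₃pts t ht
    have hvx' : r₀ ≤ dist (γ v) x' := hexcl _ hvin hvout
    have hv0 : 0 < v := by
      rcases hv.1.eq_or_lt with h | h
      · exfalso; rw [← h] at hvin; linarith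
      · exact h
    have hv1 : v < 1 := by
      rcases hv.2.eq_or_lt with h | h
      · exfalso; rw [h] at hvx'; linarith
      · exact h
    obtain ⟨hM₁, hM₂⟩ := hγout v ⟨hv0, hv1⟩
    exact ⟨v, hv, hveq, hM₁, hM₂, hr₀i.trans hvin, hvx'⟩
  have hγ₃O : ∀ t ∈ Icc (0 : ℝ) 1, γ₃ t ∉ openEdgeUnion δ ω := fun t ht => by
    obtain ⟨v, hv, hveq, -⟩ := hγ₃out t ht
    rw [hveq]; exact (hγO v hv).1
  have hγ₃S : ∀ t ∈ Icc (0 : ℝ) 1, ∀ a b : Site 2, (zdGraph 2).Adj a b → s(a, b) ∈ S →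
      γ₃ t ∉ segment ℝ (meshPoint δ a) (meshPoint δ b) := by
    intro t ht a b hab hSab hseg
    obtain ⟨v, hv, hveq, hvM, hvM', hvx, hvx'⟩ := hγ₃out t ht
    rw [hveq] at hseg
    rw [hM'eq] at hvM'
    by_cases hω : s(a, b) ∈ ω
    · exact (hγO v hv).1 (mem_openEdgeUnion_iff.2 ⟨a, b, hab, hω, hseg⟩)
    rcases hS a b hab hSab hω (γ v) hseg (hγQ v hv) hvM hvM' with hV | hd | hd'
    · exact (hγO v hv).2 hV
    · linarith
    · linarith
  have h0' : dist (γ₃ 0) x ≤ inner := by rw [hγ₃0, hγ₂0, hu₀eq]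
  exact mem_annulusDualCrossingOff_of_path hδ x hγ₃c hγ₃O hγ₃S h0' hγ₃R hγ₃1 hio

end Quad

end QuadCrossing

end Literature.Probability.Percolation
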